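import Literature.Barriers.CriticalPhenomena.LaceExpansionXSpaceTwoLongLinesSpecials
import HarnessLib

/-!
# Configurations of Hara's two-long-lines estimate (§3.5) at `p_c`: every relative position of the
# two erased lines costs a power of `𝕂 = 2d(S̄+1)` and keeps the rate `κ^{#free units}` — PROVED

Barrier catalogue `Literature/Barriers/CriticalPhenomena/` (D-0021), infrastructure for the
conditional reduction of `Hara2008_twoLongLinesDiagramBoundPc` (`LaceExpansionXSpaceLemma15Diagrams.lean`,
Hara 2008, §3.5), continuing `LaceExpansionXSpaceTwoLongLinesSpecials.lean`.

Hara: "In all these cases, we can collect at least `(N-3)` factors of `cλ` and two factors of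
`G_{x,N}` for each diagram." This file turns the junction estimates of the previous files into that
bookkeeping. The ERASED KERNELS are indexed by the coordinate of the erased line (`b1Er c`, `stEr c`,
`enEr c`, `b2oneCore c`, and the merged star block `starK`), their one-line majorants are stated
uniformly in the coordinate (`le_entry_*`, `le_exit_*`), the ENTRY PACKAGES (point mass / `Ψ^{(0)}(B₁B₂)^i`
/ the same closed by a rung) and EXIT PACKAGES (point mass / `(B₂B₁)^c A₃` / opened by a rung) have
masses `≤ 𝕂² κ^i`, the entry and exit constants are `≤ 𝕂⁷`, the triangles of the adjacent cases are
`≤ 𝕂³`. PROVED: the four GENERIC CONFIGURATIONS of the Cauchy–Schwarz regime (`cfg_rho_rho`,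
`cfg_rho_one`, `cfg_one_rho`, `cfg_one_one`: middle factor of the four families of
`LaceExpansionXSpaceTwoLongLinesShapes.lean`), each `≤ 𝕂¹⁸ κ^{i + (m-1) + c}`, and the adjacent /
lone-star / overlapping configurations in the same currency (`cfg_rungOnly`, `cfg_lone`,
`cfg_conflictA/B/C`, and the four coincident erasures `cfg_same_*`).

## References

* T. Hara, Ann. Probab. 36 (2008) 530–593 (arXiv:math-ph/0504021): §3.5 (Cases 1–2 and the
  closing paragraph).
* M. Heydenreich, R. van der Hofstad, *Progress in High-Dimensional Percolation and Random
  Graphs*, Springer 2017: (7.4.10), (7.5.9)–(7.5.12), Exercise 7.5.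
-/

noncomputable section

open scoped ENNReal

namespace Literature.Barriers.CriticalPhenomena

open _root_.MeasureTheory Literature.Probability.LatticeModels Literature.Probability.Percolation

variable {d : ℕ}

/-! ### The erased kernels indexed by the coordinate of the erased line -/

/-- The line of `B₁` on coordinate `c`: `τ` on coordinate 1 (`c = true`), `τ̃` on coordinate 2.
[cite: HeydenreichVanDerHofstad2017, (7.4.3)] -/
def lineF (d : ℕ) : Bool → Site d → ℝ≥0∞
  | true => tauPcE d
  | false => tauTildePcE d

/-- `B₁` with its line on coordinate `c` erased. [cite: Hara2008, §3.5] -/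
def b1Er (d : ℕ) : Bool → Site d × Site d → Site d × Site d → ℝ≥0∞
  | true => kProp (oneF d) (tauTildePcE d)
  | false => kProp (tauPcE d) (oneF d)

/-- The start triangle `Ψ^{(0)}` (as the kernel `kRungR P_{τ,τ}` out of `(0,0)`) with its line to
coordinate `c` erased. [cite: Hara2008, §3.5] -/
def stEr (d : ℕ) : Bool → Site d × Site d → Site d × Site d → ℝ≥0∞
  | true => kRungR (kProp (oneF d) (tauPcE d))
  | false => kRungR (kProp (tauPcE d) (oneF d))

/-- The end triangle `A₃(·, x)` (as the kernel `kRungL P_{τ,τ}` into `(x,x)`) with its line from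
coordinate `c` erased. [cite: Hara2008, §3.5] -/
def enEr (d : ℕ) : Bool → Site d × Site d → Site d × Site d → ℝ≥0∞
  | true => kRungL (kProp (oneF d) (tauPcE d))
  | false => kRungL (kProp (tauPcE d) (oneF d))

/-- `B₂⁽¹⁾` without its two rungs, with the crossed line OUT OF coordinate `c` erased
(`c = true`: the line `u → t` erased, `τ(s - v)` remains). [cite: Hara2008, §3.5] -/
def b2oneCore (d : ℕ) : Bool → Site d × Site d → Site d × Site d → ℝ≥0∞
  | true => kPropX (oneF d) (tauPcE d)
  | false => kPropX (tauPcE d) (oneF d)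

/-- The merged star block `B₁ · kB2twoEr · B₁`. [cite: Hara2008, §3.5 (Case 2, Fig. 5 (d-3))] -/
def starK (d : ℕ) : Site d × Site d → Site d × Site d → ℝ≥0∞ := pkMul (kB1 d) (pkMul (kB2twoEr d) (kB1 d))

/-- `lineF c` is even. [folklore] -/
theorem lineF_neg (c : Bool) (v : Site d) : lineF d c (-v) = lineF d c v := by
  cases c
  · exact tauTildePcE_neg v
  · exact tauPcE_neg v

/-- `lineF c ≤ 2d τ` pointwise (`d ≥ 1`). [cite: Hara2008, §3.4] -/
theorem lineF_le (hd : 1 ≤ d) (c : Bool) (v : Site d) : lineF d c v ≤ 2 * d * tauPcE d v := by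
  cases c
  · exact tauTildePcE_le v
  · exact le_mul_of_one_le_left' (one_le_two_mul_d hd)

/-- `1² Σ (lineF c)² ≤ 𝕂⁷`. [folklore] -/
theorem entryConst_lineF_le (hd : 1 ≤ d) (c : Bool) :
    (1 : ℝ≥0∞) ^ 2 * ∑' y : Site d, lineF d c y ^ 2 ≤ bigK d ^ 7 := by
  cases c
  · exact entryConst_tauTilde_le hd
  · exact entryConst_tau_le hd

/-- ENTRY — `B₁` with the line on `c` erased: the other line enters coordinate `!c`. [cite: Hara2008, §3.5] -/
theorem le_entry_b1Er (c : Bool) (p P : Site d × Site d) :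
    b1Er d c p P ≤ 1 * lineF d (!c) (crd (!c) P - crd (!c) p) * (fun _ => (1 : ℝ≥0∞)) P := by
  cases c
  · exact le_entry_kProp_oneF_right _ p P
  · exact le_entry_kProp_oneF_left _ p P

/-- EXIT — `B₁` with the line on `c` erased: the other line leaves coordinate `!c`. [cite: Hara2008, §3.5] -/
theorem le_exit_b1Er (c : Bool) (Q q : Site d × Site d) :
    b1Er d c Q q ≤ (fun _ => (1 : ℝ≥0∞)) Q * (1 * lineF d (!c) (crd (!c) Q - crd (!c) q)) := by
  cases c
  · exact le_exit_kProp_oneF_right tauPcE_neg Q q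
  · exact le_exit_kProp_oneF_left tauTildePcE_neg Q q

/-- ENTRY — the start triangle with the line to `c` erased: `τ` enters `!c`, then the rung. [cite: Hara2008, §3.5] -/
theorem le_entry_stEr (c : Bool) (p P : Site d × Site d) :
    stEr d c p P ≤ 1 * tauPcE d (crd (!c) P - crd (!c) p) * rho d P := by
  cases c
  · exact le_entry_kRungR_kProp_oneF_right _ p P
  · exact le_entry_kRungR_kProp_oneF_left _ p P

/-- EXIT — the end triangle with the line from `c` erased: the rung, then `τ` out of `!c`. [cite: Hara2008, §3.5] -/
theorem le_exit_enEr (c : Bool) (Q q : Site d × Site d) :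
    enEr d c Q q ≤ rho d Q * (1 * tauPcE d (crd (!c) Q - crd (!c) q)) := by
  cases c
  · exact le_exit_kRungL_kProp_oneF_right tauPcE_neg Q q
  · exact le_exit_kRungL_kProp_oneF_left tauPcE_neg Q q

/-- ENTRY — `B₂⁽¹⁾` with the crossed line out of `c` erased (input rung moved left): the other
crossed line enters coordinate `c`, then the output rung. [cite: Hara2008, §3.5] -/
theorem le_entry_b2one (c : Bool) (p P : Site d × Site d) :
    kRungR (b2oneCore d c) p P ≤ 1 * tauPcE d (crd c P - crd (!c) p) * rho d P := by
  cases c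
  · exact le_entry_kRungR_kPropX_oneF_right _ p P
  · exact le_entry_kRungR_kPropX_oneF_left _ p P

/-- EXIT — `B₂⁽¹⁾` with the crossed line out of `c` erased (output rung moved right): the input
rung, then the other crossed line out of coordinate `!c`. [cite: Hara2008, §3.5] -/
theorem le_exit_b2one (c : Bool) (Q q : Site d × Site d) :
    kRungL (b2oneCore d c) Q q ≤ rho d Q * (1 * tauPcE d (crd (!c) Q - crd c q)) := by
  cases c
  · exact le_exit_kRungL_kPropX_oneF_right tauPcE_neg Q q
  · exact le_exit_kRungL_kPropX_oneF_left tauPcE_neg Q q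

/-- ENTRY — the merged star block: `≤ (Δ̃Δ̄) bbT` into coordinate 1. [cite: Hara2008, §3.5 (Case 2)] -/
theorem le_entry_starK (p P : Site d × Site d) :
    starK d p P ≤ (percTriTildeBar d * percTriBar d) * bbT d (crd true P - p.2) * (fun _ => (1 : ℝ≥0∞)) P :=
  le_entry_star p P

/-- EXIT — the merged star block: `≤ (Δ̃Δ̄) bbT` out of coordinate 2. [cite: Hara2008, §3.5 (Case 2)] -/
theorem le_exit_starK (Q q : Site d × Site d) :
    starK d Q q ≤ (fun _ => (1 : ℝ≥0∞)) Q * ((percTriTildeBar d * percTriBar d) * bbT d (crd false Q - q.1)) :=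
  le_exit_star Q q

/-! ### The triangles of the adjacent cases are `≤ 𝕂³` -/

/-- Monotonicity and homogeneity of the `T`-form in both lines. [folklore] -/
theorem tForm_le_of_le {f g f₀ g₀ : Site d → ℝ≥0∞} {a b : ℝ≥0∞} (hf : ∀ v, f v ≤ a * f₀ v)
    (hg : ∀ v, g v ≤ b * g₀ v) : tForm d f g ≤ a * b * tForm d f₀ g₀ := by
  calc tForm d f g ≤ tForm d (fun v => a * f₀ v) (fun v => b * g₀ v) :=
        iSup_mono fun _ => ENNReal.tsum_le_tsum fun _ => mul_le_mul' (mul_le_mul' (hf _) (hg _)) le_rfl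
    _ = b * tForm d (fun v => a * f₀ v) g₀ := tForm_const_mul_right _ _ _
    _ = b * tForm d g₀ (fun v => a * f₀ v) := by rw [tForm_comm]
    _ = b * (a * tForm d g₀ f₀) := by rw [tForm_const_mul_right]
    _ = a * b * tForm d f₀ g₀ := by rw [tForm_comm]; ring

/-- `T(τ, τ⋆τ) ≤ S̄` (four lines in series). [cite: Hara2008, §1.1] -/
theorem tForm_tau_percBubble_le : tForm d (tauPcE d) (percBubble d) ≤ percSqBar d := by
  refine iSup_le fun a => ?_
  calc ∑' xy : Site d × Site d, tauPcE d xy.1 * percBubble d (xy.2 - xy.1) * tauPcE d (a - xy.2)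
      = ∑' x : Site d, tauPcE d x * ∑' y : Site d, percBubble d (y - x) * tauPcE d (a - y) := by
        rw [ENNReal.tsum_prod']
        refine tsum_congr fun x => ?_
        rw [← ENNReal.tsum_mul_left]
        exact tsum_congr fun y => mul_assoc _ _ _
    _ = ∑' x : Site d, tauPcE d x * percTri d (a - x) := by
        refine tsum_congr fun x => ?_
        congr 1
        rw [percTri_eq_tsum_percBubble_mul_tau, tsum_shift _ x]
        exact tsum_congr fun y => by rw [add_sub_cancel_right, show a - (y + x) = a - x - y by abel]
    _ = percSq d a := (percSq_eq_tsum_tau_mul_percTri a).symm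
    _ ≤ percSqBar d := percSq_le_percSqBar a

/-- **`T(lineF c, lineF c') ≤ 𝕂³`** (`d ≥ 1`). [cite: Hara2008, §3.5 (Case 1)] -/
theorem tForm_lineF_lineF_le (hd : 1 ≤ d) (c c' : Bool) : tForm d (lineF d c) (lineF d c') ≤ bigK d ^ 3 := by
  calc tForm d (lineF d c) (lineF d c') ≤ (2 * d) * (2 * d) * tForm d (tauPcE d) (tauPcE d) :=
        tForm_le_of_le (lineF_le hd c) (lineF_le hd c')
    _ ≤ bigK d * bigK d * bigK d := by
        rw [tForm_tau_tau]; exact mul_le_mul' (mul_le_mul' two_mul_d_le_bigK two_mul_d_le_bigK) (percTriBar_le_bigK hd)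
    _ = bigK d ^ 3 := by ring

/-- **`T(lineF c, bbT) ≤ 𝕂³`** (`d ≥ 1`). [cite: Hara2008, §3.5 (Case 2)] -/
theorem tForm_lineF_bbT_le (hd : 1 ≤ d) (c : Bool) : tForm d (lineF d c) (bbT d) ≤ bigK d ^ 3 := by
  calc tForm d (lineF d c) (bbT d) ≤ (2 * d) * (2 * d) * tForm d (tauPcE d) (percBubble d) :=
        tForm_le_of_le (lineF_le hd c) bbT_le_percBubble
    _ ≤ bigK d * bigK d * bigK d :=
        mul_le_mul' (mul_le_mul' two_mul_d_le_bigK two_mul_d_le_bigK) (tForm_tau_percBubble_le.trans (percSqBar_le_bigK hd))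
    _ = bigK d ^ 3 := by ring

/-- **`T(bbT, lineF c) ≤ 𝕂³`** (`d ≥ 1`). [cite: Hara2008, §3.5 (Case 2)] -/
theorem tForm_bbT_lineF_le (hd : 1 ≤ d) (c : Bool) : tForm d (bbT d) (lineF d c) ≤ bigK d ^ 3 := by
  rw [tForm_comm]; exact tForm_lineF_bbT_le hd c

/-! ### Masses of the entry and exit packages, in the currency `𝕂² κ^i` -/

/-- ENTRY `V` (an erased start line): the chain starts at the point mass, `Σ δ ≤ 𝕂² κ⁰`. [folklore] -/
theorem mass_entry_V (hd : 1 ≤ d) : ∑' p : Site d × Site d, pkChainL (vDelta d) [] p ≤ bigK d ^ 2 * kap d ^ 0 := by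
  rw [pow_zero, mul_one]
  exact tsum_vDelta_le.trans ((one_le_bigK hd).trans (self_le_bigK_pow hd (by norm_num)))

/-- ENTRY at `B₁(2i)` or at the star of unit `i+1`: `Σ Ψ^{(0)}(B₁B₂)^i ≤ 𝕂² κ^i`.
[cite: HeydenreichVanDerHofstad2017, (7.5.9)–(7.5.12)] -/
theorem mass_entry_B1 (hd : 1 ≤ d) (i : ℕ) :
    ∑' p, pkChainL (kPsiZero d) (altL d true (2 * i)) p ≤ bigK d ^ 2 * kap d ^ i :=
  (tsum_pkChainL_kPsiZero_altL_le i).trans (mul_le_mul' ((percTri_le_bigK hd 0).trans (self_le_bigK_pow hd (by norm_num))) le_rfl)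

/-- ENTRY at `B₂⁽¹⁾(2i+1)` (its input rung on the previous `B₁`): `Σ Ψ^{(0)}(B₁B₂)^i B₁ρ ≤ 𝕂² κ^i`.
[cite: HeydenreichVanDerHofstad2017, (7.5.9)–(7.5.13)] -/
theorem mass_entry_B2 (hd : 1 ≤ d) (i : ℕ) :
    ∑' p, pkChainL (kPsiZero d) (altL d true (2 * i) ++ [pkScaleR (kB1 d) (rho d)]) p ≤ bigK d ^ 2 * kap d ^ i := by
  calc ∑' p, pkChainL (kPsiZero d) (altL d true (2 * i) ++ [pkScaleR (kB1 d) (rho d)]) p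
      ≤ percTri d 0 * kap d ^ i * percTriTildeBar d := tsum_pkChainL_kPsiZero_altL_rho_le i
    _ ≤ bigK d * kap d ^ i * bigK d := mul_le_mul' (mul_le_mul' (percTri_le_bigK hd 0) le_rfl) percTriTildeBar_le_bigK
    _ = bigK d ^ 2 * kap d ^ i := by ring

/-- EXIT `E` (an erased end line): the chain ends at the point mass, `Σ δ ≤ 𝕂² κ⁰`. [folklore] -/
theorem mass_exit_E (hd : 1 ≤ d) (q₀ : Site d × Site d) :
    ∑' q, pkChainR [] (fun q => if q = q₀ then (1 : ℝ≥0∞) else 0) q ≤ bigK d ^ 2 * kap d ^ 0 := by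
  rw [pow_zero, mul_one]
  exact (tsum_pkChainR_nil_point q₀).trans ((one_le_bigK hd).trans (self_le_bigK_pow hd (by norm_num)))

/-- EXIT at `B₁` or at a star: `Σ (B₂B₁)^c A₃(·,x) ≤ 𝕂² κ^c`. [cite: HeydenreichVanDerHofstad2017, Exercise 7.5] -/
theorem mass_exit_B1 (hd : 1 ≤ d) (c₃ : ℕ) (x : Site d) :
    ∑' q, pkChainR (altL d false (2 * c₃)) (fun q => kA3end d q x) q ≤ bigK d ^ 2 * kap d ^ c₃ := by
  calc ∑' q, pkChainR (altL d false (2 * c₃)) (fun q => kA3end d q x) q ≤ kap d ^ c₃ * percTri d 0 :=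
        tsum_pkChainR_altL_kA3end_le c₃ x
    _ ≤ kap d ^ c₃ * bigK d ^ 2 := mul_le_mul' le_rfl ((percTri_le_bigK hd 0).trans (self_le_bigK_pow hd (by norm_num)))
    _ = bigK d ^ 2 * kap d ^ c₃ := mul_comm _ _

/-- EXIT at `B₂⁽¹⁾` (its output rung on the next `B₁`): `Σ ρB₁(B₂B₁)^c A₃(·,x) ≤ 𝕂² κ^c`.
[cite: HeydenreichVanDerHofstad2017, Exercise 7.5] -/
theorem mass_exit_B2 (hd : 1 ≤ d) (c₃ : ℕ) (x : Site d) :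
    ∑' q, pkChainR (pkScaleL (rho d) (kB1 d) :: altL d false (2 * c₃)) (fun q => kA3end d q x) q ≤
      bigK d ^ 2 * kap d ^ c₃ := by
  calc ∑' q, pkChainR (pkScaleL (rho d) (kB1 d) :: altL d false (2 * c₃)) (fun q => kA3end d q x) q
      ≤ percTriTildeBar d * kap d ^ c₃ * percTri d 0 := tsum_pkChainR_rho_altL_kA3end_le c₃ x
    _ ≤ bigK d * kap d ^ c₃ * bigK d := mul_le_mul' (mul_le_mul' percTriTildeBar_le_bigK le_rfl) (percTri_le_bigK hd 0)
    _ = bigK d ^ 2 * kap d ^ c₃ := by ring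

/-! ### The four generic configurations of the Cauchy–Schwarz regime -/

/-- `κ^m ≤ κ^{m-1}` for `κ ≤ 1`. [folklore] -/
theorem kap_pow_le_pred {m : ℕ} (hκ : kap d ≤ 1) : kap d ^ m ≤ kap d ^ (m - 1) :=
  pow_le_pow_of_le_one zero_le hκ (Nat.sub_le m 1)

/-- The arithmetic of the Cauchy–Schwarz configurations: masses `𝕂²κ^i`, `𝕂²κ^c`, constants `𝕂⁷`,
head and tail `𝕂⁷κ^{m-1}` give the square of `𝕂¹⁸ κ^{i + (m-1) + c}`. [folklore] -/
theorem cfg_arith (i m c₃ : ℕ) :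
    (bigK d ^ 2 * kap d ^ i) ^ 2 * bigK d ^ 7 * (bigK d ^ 7 * kap d ^ (m - 1)) *
      ((bigK d ^ 2 * kap d ^ c₃) ^ 2 * bigK d ^ 7 * (bigK d ^ 7 * kap d ^ (m - 1))) ≤
      (bigK d ^ 18 * kap d ^ (i + (m - 1) + c₃)) ^ 2 :=
  le_of_eq (by ring)

/-- **Configuration `ρ … ρ`** (entry = erased start line or `B₂⁽¹⁾`, exit = erased end line or
`B₂⁽¹⁾`; middle factor `ρ B₁ (B₂B₁)^m ρ'`): `≤ 𝕂¹⁸ κ^{i + (m-1) + c}`.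
[cite: Hara2008, §3.5 (Case 2 and the closing paragraph)] -/
theorem cfg_rho_rho (hd : 1 ≤ d) (v e : Site d × Site d → ℝ≥0∞)
    (Lpre Rpost : List (Site d × Site d → Site d × Site d → ℝ≥0∞))
    (X Y : Site d × Site d → Site d × Site d → ℝ≥0∞) (e1 e2 : Bool)
    {cF cG : ℝ≥0∞} {f g : Site d → ℝ≥0∞} {πF πG : Site d × Site d → Site d} (i m c₃ : ℕ)
    (hX : ∀ p P, X p P ≤ cF * f (crd e1 P - πF p) * rho d P)
    (hY : ∀ Q q, Y Q q ≤ rho d Q * (cG * g (crd e2 Q - πG q)))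
    (h₁ : ∑' p, pkChainL v Lpre p ≤ bigK d ^ 2 * kap d ^ i) (hA : cF ^ 2 * ∑' a, f a ^ 2 ≤ bigK d ^ 7)
    (hC : cG ^ 2 * ∑' a, g a ^ 2 ≤ bigK d ^ 7) (h₂ : ∑' q, pkChainR Rpost e q ≤ bigK d ^ 2 * kap d ^ c₃) :
    ∑' s, pkChainL v (Lpre ++ X :: (altL d true (2 * m + 1) ++ Y :: Rpost)) s * e s ≤
      bigK d ^ 18 * kap d ^ (i + (m - 1) + c₃) := by
  refine chain_cs_le v e Lpre (altL d true (2 * m + 1)) Rpost X Y e1 e2 hX hY h₁ hA ?_ ?_ hC h₂ (cfg_arith i m c₃)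
  · exact (head_fam_B1B1 hd e1 m).trans (mul_le_mul' (bigK_pow_mono hd (by norm_num)) le_rfl)
  · exact (tail_fam_B1B1 hd e2 m).trans (mul_le_mul' (bigK_pow_mono hd (by norm_num)) le_rfl)

/-- **Configuration `ρ … 1`** (entry with a rung, exit = `B₁` or the star; middle factor
`ρ B₁B₂ (B₁B₂)^m`): `≤ 𝕂¹⁸ κ^{i + (m-1) + c}`. [cite: Hara2008, §3.5] -/
theorem cfg_rho_one (hd : 1 ≤ d) (hκ : kap d ≤ 1) (v e : Site d × Site d → ℝ≥0∞)
    (Lpre Rpost : List (Site d × Site d → Site d × Site d → ℝ≥0∞))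
    (X Y : Site d × Site d → Site d × Site d → ℝ≥0∞) (e1 e2 : Bool)
    {cF cG : ℝ≥0∞} {f g : Site d → ℝ≥0∞} {πF πG : Site d × Site d → Site d} (i m c₃ : ℕ)
    (hX : ∀ p P, X p P ≤ cF * f (crd e1 P - πF p) * rho d P)
    (hY : ∀ Q q, Y Q q ≤ (fun _ => (1 : ℝ≥0∞)) Q * (cG * g (crd e2 Q - πG q)))
    (h₁ : ∑' p, pkChainL v Lpre p ≤ bigK d ^ 2 * kap d ^ i) (hA : cF ^ 2 * ∑' a, f a ^ 2 ≤ bigK d ^ 7)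
    (hC : cG ^ 2 * ∑' a, g a ^ 2 ≤ bigK d ^ 7) (h₂ : ∑' q, pkChainR Rpost e q ≤ bigK d ^ 2 * kap d ^ c₃) :
    ∑' s, pkChainL v (Lpre ++ X :: (altL d true (2 * m + 2) ++ Y :: Rpost)) s * e s ≤
      bigK d ^ 18 * kap d ^ (i + (m - 1) + c₃) := by
  have hone : ∀ q : Site d × Site d, (fun _ : Site d × Site d => (1 : ℝ≥0∞)) q ≤ 1 := fun _ => le_rfl
  refine chain_cs_le v e Lpre (altL d true (2 * m + 2)) Rpost X Y e1 e2 hX hY h₁ hA ?_ ?_ hC h₂ (cfg_arith i m c₃)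
  · exact (head_fam_B1B2 hd e1 m hone).trans (mul_le_mul' (bigK_pow_mono hd (by norm_num)) (kap_pow_le_pred hκ))
  · exact tail_fam_B1B2 hd e2 m hone hκ

/-- **Configuration `1 … ρ`** (entry = `B₁` or the star, exit with a rung; middle factor
`(B₂B₁)^{m+1} ρ`): `≤ 𝕂¹⁸ κ^{i + (m-1) + c}`. [cite: Hara2008, §3.5] -/
theorem cfg_one_rho (hd : 1 ≤ d) (hκ : kap d ≤ 1) (v e : Site d × Site d → ℝ≥0∞)
    (Lpre Rpost : List (Site d × Site d → Site d × Site d → ℝ≥0∞))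
    (X Y : Site d × Site d → Site d × Site d → ℝ≥0∞) (e1 e2 : Bool)
    {cF cG : ℝ≥0∞} {f g : Site d → ℝ≥0∞} {πF πG : Site d × Site d → Site d} (i m c₃ : ℕ)
    (hX : ∀ p P, X p P ≤ cF * f (crd e1 P - πF p) * (fun _ => (1 : ℝ≥0∞)) P)
    (hY : ∀ Q q, Y Q q ≤ rho d Q * (cG * g (crd e2 Q - πG q)))
    (h₁ : ∑' p, pkChainL v Lpre p ≤ bigK d ^ 2 * kap d ^ i) (hA : cF ^ 2 * ∑' a, f a ^ 2 ≤ bigK d ^ 7)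
    (hC : cG ^ 2 * ∑' a, g a ^ 2 ≤ bigK d ^ 7) (h₂ : ∑' q, pkChainR Rpost e q ≤ bigK d ^ 2 * kap d ^ c₃) :
    ∑' s, pkChainL v (Lpre ++ X :: (altL d false (2 * m + 2) ++ Y :: Rpost)) s * e s ≤
      bigK d ^ 18 * kap d ^ (i + (m - 1) + c₃) := by
  have hone : ∀ q : Site d × Site d, (fun _ : Site d × Site d => (1 : ℝ≥0∞)) q ≤ 1 := fun _ => le_rfl
  refine chain_cs_le v e Lpre (altL d false (2 * m + 2)) Rpost X Y e1 e2 hX hY h₁ hA ?_ ?_ hC h₂ (cfg_arith i m c₃)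
  · exact head_fam_B2B1 hd e1 m hone hκ
  · exact (tail_fam_B2B1 hd e2 m hone).trans (mul_le_mul' (bigK_pow_mono hd (by norm_num)) (kap_pow_le_pred hκ))

/-- **Configuration `1 … 1`** (entry = `B₁` or the star, exit = `B₁` or the star, at least one full
unit between; middle factor `B₂(B₁B₂)^m`, `m ≥ 1`): `≤ 𝕂¹⁸ κ^{i + (m-1) + c}`. [cite: Hara2008, §3.5] -/
theorem cfg_one_one (hd : 1 ≤ d) (hκ : kap d ≤ 1) (v e : Site d × Site d → ℝ≥0∞)
    (Lpre Rpost : List (Site d × Site d → Site d × Site d → ℝ≥0∞))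
    (X Y : Site d × Site d → Site d × Site d → ℝ≥0∞) (e1 e2 : Bool)
    {cF cG : ℝ≥0∞} {f g : Site d → ℝ≥0∞} {πF πG : Site d × Site d → Site d} (i : ℕ) {m : ℕ} (hm : 1 ≤ m) (c₃ : ℕ)
    (hX : ∀ p P, X p P ≤ cF * f (crd e1 P - πF p) * (fun _ => (1 : ℝ≥0∞)) P)
    (hY : ∀ Q q, Y Q q ≤ (fun _ => (1 : ℝ≥0∞)) Q * (cG * g (crd e2 Q - πG q)))
    (h₁ : ∑' p, pkChainL v Lpre p ≤ bigK d ^ 2 * kap d ^ i) (hA : cF ^ 2 * ∑' a, f a ^ 2 ≤ bigK d ^ 7)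
    (hC : cG ^ 2 * ∑' a, g a ^ 2 ≤ bigK d ^ 7) (h₂ : ∑' q, pkChainR Rpost e q ≤ bigK d ^ 2 * kap d ^ c₃) :
    ∑' s, pkChainL v (Lpre ++ X :: (altL d false (2 * m + 1) ++ Y :: Rpost)) s * e s ≤
      bigK d ^ 18 * kap d ^ (i + (m - 1) + c₃) := by
  have hone : ∀ q : Site d × Site d, (fun _ : Site d × Site d => (1 : ℝ≥0∞)) q ≤ 1 := fun _ => le_rfl
  refine chain_cs_le v e Lpre (altL d false (2 * m + 1)) Rpost X Y e1 e2 hX hY h₁ hA ?_ ?_ hC h₂ (cfg_arith i m c₃)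
  · exact head_fam_B2B2 hd e1 hm hone hone hκ
  · exact tail_fam_B2B2 hd e2 hm hone hone hκ

/-! ### The special configurations in the same currency -/

/-- The arithmetic of the adjacent configuration. [folklore] -/
theorem rungOnly_arith (hd : 1 ≤ d) (i c₃ : ℕ) {cF cG T : ℝ≥0∞} (hF : cF ≤ bigK d ^ 2) (hG : cG ≤ bigK d ^ 2)
    (hT : T ≤ bigK d ^ 3) :
    bigK d ^ 2 * kap d ^ i * (cF * cG * T) * (bigK d ^ 2 * kap d ^ c₃) ≤ bigK d ^ 18 * kap d ^ (i + c₃) := by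
  calc bigK d ^ 2 * kap d ^ i * (cF * cG * T) * (bigK d ^ 2 * kap d ^ c₃)
      ≤ bigK d ^ 2 * kap d ^ i * (bigK d ^ 2 * bigK d ^ 2 * bigK d ^ 3) * (bigK d ^ 2 * kap d ^ c₃) :=
        mul_le_mul' (mul_le_mul' le_rfl (mul_le_mul' (mul_le_mul' hF hG) hT)) le_rfl
    _ = bigK d ^ 11 * kap d ^ (i + c₃) := by ring
    _ ≤ bigK d ^ 18 * kap d ^ (i + c₃) := mul_le_mul' (bigK_pow_mono hd (by norm_num)) le_rfl

/-- **Adjacent erasures** in the currency: `≤ 𝕂¹⁸ κ^{i + c}`. [cite: Hara2008, §3.5 (Case 1)] -/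
theorem cfg_rungOnly (hd : 1 ≤ d) (v e : Site d × Site d → ℝ≥0∞)
    (Lpre Rpost : List (Site d × Site d → Site d × Site d → ℝ≥0∞))
    (X Y : Site d × Site d → Site d × Site d → ℝ≥0∞) (e1 e2 : Bool) (he : e1 ≠ e2)
    {cF cG : ℝ≥0∞} {f g : Site d → ℝ≥0∞} {πF πG : Site d × Site d → Site d}
    {ρ₁ ρ₂ : Site d × Site d → ℝ≥0∞} (i c₃ : ℕ)
    (hX : ∀ p P, X p P ≤ cF * f (crd e1 P - πF p) * ρ₁ P)
    (hY : ∀ Q q, Y Q q ≤ ρ₂ Q * (cG * g (crd e2 Q - πG q)))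
    (hρ : ∀ P, ρ₁ P * ρ₂ P ≤ rho d P) (hf : ∀ v, f (-v) = f v) (hg : ∀ v, g (-v) = g v)
    (hF : cF ≤ bigK d ^ 2) (hG : cG ≤ bigK d ^ 2) (hT : tForm d f g ≤ bigK d ^ 3)
    (h₁ : ∑' p, pkChainL v Lpre p ≤ bigK d ^ 2 * kap d ^ i) (h₂ : ∑' q, pkChainR Rpost e q ≤ bigK d ^ 2 * kap d ^ c₃) :
    ∑' s, pkChainL v (Lpre ++ X :: Y :: Rpost) s * e s ≤ bigK d ^ 18 * kap d ^ (i + c₃) :=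
  (chain_rungOnly_le v e Lpre Rpost X Y e1 e2 he hX hY hρ hf hg h₁ h₂ le_rfl).trans (rungOnly_arith hd i c₃ hF hG hT)

/-- **The lone star block** in the currency: `≤ 𝕂¹⁸ κ^{i + c}`. [cite: Hara2008, §3.5 (Case 2)] -/
theorem cfg_lone (hd : 1 ≤ d) (v e : Site d × Site d → ℝ≥0∞)
    (Lpre Rpost : List (Site d × Site d → Site d × Site d → ℝ≥0∞))
    (X Y : Site d × Site d → Site d × Site d → ℝ≥0∞) (eC : Bool)
    {cF cG : ℝ≥0∞} {f g : Site d → ℝ≥0∞} {πF πG : Site d × Site d → Site d} (i c₃ : ℕ)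
    (hX : ∀ p P, X p P ≤ cF * f (crd eC P - πF p) * (fun _ => (1 : ℝ≥0∞)) P)
    (hY : ∀ Q q, Y Q q ≤ (fun _ => (1 : ℝ≥0∞)) Q * (cG * g (crd eC Q - πG q)))
    (hg : ∀ v, g (-v) = g v) (hF : cF ≤ bigK d ^ 2) (hG : cG ≤ bigK d ^ 2)
    (hA : cF ^ 2 * ∑' a, f a ^ 2 ≤ bigK d ^ 7) (hC : cG ^ 2 * ∑' a, g a ^ 2 ≤ bigK d ^ 7)
    (hT : tForm d f g ≤ bigK d ^ 3)
    (h₁ : ∑' p, pkChainL v Lpre p ≤ bigK d ^ 2 * kap d ^ i) (h₂ : ∑' q, pkChainR Rpost e q ≤ bigK d ^ 2 * kap d ^ c₃) :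
    ∑' s, pkChainL v (Lpre ++ X :: kB2 d :: Y :: Rpost) s * e s ≤ bigK d ^ 18 * kap d ^ (i + c₃) := by
  refine (chain_loneB2_le v e Lpre Rpost X Y eC hX hY hg h₁ h₂ hA hC hT).trans ?_
  calc bigK d ^ 2 * kap d ^ i * (bigK d ^ 2 * kap d ^ c₃) * (bigK d ^ 7 * percSqBar d + cF * cG * percTri d 0 * bigK d ^ 3)
      ≤ bigK d ^ 2 * kap d ^ i * (bigK d ^ 2 * kap d ^ c₃) * (bigK d ^ 7 * bigK d + bigK d ^ 2 * bigK d ^ 2 * bigK d * bigK d ^ 3) :=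
        mul_le_mul' le_rfl (add_le_add (mul_le_mul' le_rfl (percSqBar_le_bigK hd))
          (mul_le_mul' (mul_le_mul' (mul_le_mul' hF hG) (percTri_le_bigK hd 0)) le_rfl))
    _ = bigK d ^ 12 * kap d ^ (i + c₃) + bigK d ^ 12 * kap d ^ (i + c₃) := by ring
    _ = 2 * (bigK d ^ 12 * kap d ^ (i + c₃)) := (two_mul _).symm
    _ ≤ bigK d * (bigK d ^ 12 * kap d ^ (i + c₃)) := mul_le_mul' (two_le_bigK hd) le_rfl
    _ = bigK d ^ 13 * kap d ^ (i + c₃) := by ring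
    _ ≤ bigK d ^ 18 * kap d ^ (i + c₃) := mul_le_mul' (bigK_pow_mono hd (by norm_num)) le_rfl

/-- **Overlap A** as a chain: `Ψ^{(0)}(B₁B₂)^i · (P_{τ,1} S B₁) · (B₂B₁)^c A₃ ≤ 𝕂¹⁸ κ^{i+c}`.
[cite: Hara2008, §3.5 (Case 2)] -/
theorem cfg_conflictA (hd : 1 ≤ d) (i c₃ : ℕ) (x : Site d) :
    ∑' s, pkChainL (kPsiZero d) (altL d true (2 * i) ++ kProp (tauPcE d) (oneF d) :: kB2twoEr d :: kB1 d ::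
      altL d false (2 * c₃)) s * kA3end d s x ≤ bigK d ^ 18 * kap d ^ (i + c₃) := by
  have h1 := pkChainL_append_cons_cons (kPsiZero d) (altL d true (2 * i) ++ [kProp (tauPcE d) (oneF d)]) (kB2twoEr d)
    (kB1 d) (altL d false (2 * c₃))
  simp only [List.append_assoc, List.singleton_append] at h1
  rw [h1, pkChainL_append_cons_cons]
  refine (chain_sup_le (kPsiZero d) (fun s => kA3end d s x) _ _ _ (fun p q => conflictA_le p q)
    (mass_entry_B1 hd i) (mass_exit_B1 hd c₃ x)).trans ?_
  calc bigK d ^ 2 * kap d ^ i * (percTriTildeBar d * percSqBar d) * (bigK d ^ 2 * kap d ^ c₃)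
      ≤ bigK d ^ 2 * kap d ^ i * (bigK d * bigK d) * (bigK d ^ 2 * kap d ^ c₃) :=
        mul_le_mul' (mul_le_mul' le_rfl (mul_le_mul' percTriTildeBar_le_bigK (percSqBar_le_bigK hd))) le_rfl
    _ = bigK d ^ 6 * kap d ^ (i + c₃) := by ring
    _ ≤ bigK d ^ 18 * kap d ^ (i + c₃) := mul_le_mul' (bigK_pow_mono hd (by norm_num)) le_rfl

/-- **Overlap B** as a chain: `Ψ^{(0)}(B₁B₂)^i · (B₁ S P_{1,τ̃}) · (B₂B₁)^c A₃ ≤ 𝕂¹⁸ κ^{i+c}`.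
[cite: Hara2008, §3.5 (Case 2)] -/
theorem cfg_conflictB (hd : 1 ≤ d) (i c₃ : ℕ) (x : Site d) :
    ∑' s, pkChainL (kPsiZero d) (altL d true (2 * i) ++ kB1 d :: kB2twoEr d :: kProp (oneF d) (tauTildePcE d) ::
      altL d false (2 * c₃)) s * kA3end d s x ≤ bigK d ^ 18 * kap d ^ (i + c₃) := by
  have h1 := pkChainL_append_cons_cons (kPsiZero d) (altL d true (2 * i) ++ [kB1 d]) (kB2twoEr d)
    (kProp (oneF d) (tauTildePcE d)) (altL d false (2 * c₃))
  simp only [List.append_assoc, List.singleton_append] at h1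
  rw [h1, pkChainL_append_cons_cons]
  refine (chain_sup_le (kPsiZero d) (fun s => kA3end d s x) _ _ _ (fun p q => conflictB_le p q)
    (mass_entry_B1 hd i) (mass_exit_B1 hd c₃ x)).trans ?_
  calc bigK d ^ 2 * kap d ^ i * (2 * d * (percTriTildeBar d * percSqBar d)) * (bigK d ^ 2 * kap d ^ c₃)
      ≤ bigK d ^ 2 * kap d ^ i * (bigK d * (bigK d * bigK d)) * (bigK d ^ 2 * kap d ^ c₃) :=
        mul_le_mul' (mul_le_mul' le_rfl (mul_le_mul' two_mul_d_le_bigK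
          (mul_le_mul' percTriTildeBar_le_bigK (percSqBar_le_bigK hd)))) le_rfl
    _ = bigK d ^ 7 * kap d ^ (i + c₃) := by ring
    _ ≤ bigK d ^ 18 * kap d ^ (i + c₃) := mul_le_mul' (bigK_pow_mono hd (by norm_num)) le_rfl

/-- **Overlap C** as a chain: `Ψ^{(0)}(B₁B₂)^i · (B₁ S B₁ S B₁) · (B₂B₁)^c A₃ ≤ 𝕂¹⁸ κ^{i+c}`.
[cite: Hara2008, §3.5 (Case 2)] -/
theorem cfg_conflictC (hd : 1 ≤ d) (i c₃ : ℕ) (x : Site d) :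
    ∑' s, pkChainL (kPsiZero d) (altL d true (2 * i) ++ kB1 d :: kB2twoEr d :: kB1 d :: kB2twoEr d :: kB1 d ::
      altL d false (2 * c₃)) s * kA3end d s x ≤ bigK d ^ 18 * kap d ^ (i + c₃) := by
  have hmerge : pkChainL (kPsiZero d) (altL d true (2 * i) ++ kB1 d :: kB2twoEr d :: kB1 d :: kB2twoEr d :: kB1 d ::
      altL d false (2 * c₃)) = pkChainL (kPsiZero d) (altL d true (2 * i) ++
        pkMul (pkMul (kB1 d) (pkMul (kB2twoEr d) (kB1 d))) (pkMul (kB2twoEr d) (kB1 d)) :: altL d false (2 * c₃)) := by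
    have h1 := pkChainL_append_cons_cons (kPsiZero d) (altL d true (2 * i) ++ [kB1 d]) (kB2twoEr d) (kB1 d)
      (kB2twoEr d :: kB1 d :: altL d false (2 * c₃))
    simp only [List.append_assoc, List.singleton_append] at h1
    rw [h1, pkChainL_append_cons_cons]
    have h2 := pkChainL_append_cons_cons (kPsiZero d) (altL d true (2 * i) ++ [pkMul (kB1 d) (pkMul (kB2twoEr d) (kB1 d))])
      (kB2twoEr d) (kB1 d) (altL d false (2 * c₃))
    simp only [List.append_assoc, List.singleton_append] at h2
    rw [h2, pkChainL_append_cons_cons]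
  rw [hmerge]
  refine (chain_sup_le (kPsiZero d) (fun s => kA3end d s x) _ _ _ (fun p q => conflictC_le p q)
    (mass_entry_B1 hd i) (mass_exit_B1 hd c₃ x)).trans ?_
  calc bigK d ^ 2 * kap d ^ i * (2 * d * (percTriTildeBar d ^ 2 * percTriBar d * percSqBar d)) * (bigK d ^ 2 * kap d ^ c₃)
      ≤ bigK d ^ 2 * kap d ^ i * (bigK d * (bigK d ^ 2 * bigK d * bigK d)) * (bigK d ^ 2 * kap d ^ c₃) :=
        mul_le_mul' (mul_le_mul' le_rfl (mul_le_mul' two_mul_d_le_bigK (mul_le_mul'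
          (mul_le_mul' (pow_le_pow_left' percTriTildeBar_le_bigK 2) (percTriBar_le_bigK hd)) (percSqBar_le_bigK hd)))) le_rfl
    _ = bigK d ^ 9 * kap d ^ (i + c₃) := by ring
    _ ≤ bigK d ^ 18 * kap d ^ (i + c₃) := mul_le_mul' (bigK_pow_mono hd (by norm_num)) le_rfl

/-! ### The coincident erasures (both long lines in the same kernel) -/

/-- **Both start lines erased**: `Σ_P ρ(P) (B₁ (B₂B₁)^n A₃(·,x))(P) ≤ 𝕂¹⁸ κ^n`.
[cite: Hara2008, §3.5 ("(2N+1)² choices")] -/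
theorem cfg_same_V (hd : 1 ≤ d) (n : ℕ) (x : Site d) :
    ∑' P, rho d P * pkChainR (kB1 d :: altL d false (2 * n)) (fun q => kA3end d q x) P ≤ bigK d ^ 18 * kap d ^ n := by
  rw [tsum_rho_mul_pkChainR_cons]
  exact (mass_exit_B2 hd n x).trans (mul_le_mul' (bigK_pow_mono hd (by norm_num)) le_rfl)

/-- **Both end lines erased**: `Σ_Q (Ψ^{(0)}(B₁B₂)^n B₁)(Q) ρ(Q) ≤ 𝕂¹⁸ κ^n`. [cite: Hara2008, §3.5] -/
theorem cfg_same_E (hd : 1 ≤ d) (n : ℕ) :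
    ∑' Q, pkChainL (kPsiZero d) (altL d true (2 * n) ++ [kB1 d]) Q * rho d Q ≤ bigK d ^ 18 * kap d ^ n := by
  rw [tsum_pkChainL_snoc_mul]
  exact (mass_entry_B2 hd n).trans (mul_le_mul' (bigK_pow_mono hd (by norm_num)) le_rfl)

/-- **Both lines of one `B₁(2i)` erased** (a constant kernel): `≤ 𝕂¹⁸ κ^{i + c}`. [cite: Hara2008, §3.5] -/
theorem cfg_same_B1 (hd : 1 ≤ d) (i c₃ : ℕ) (x : Site d) :
    ∑' s, pkChainL (kPsiZero d) (altL d true (2 * i) ++ kProp (oneF d) (oneF d) :: altL d false (2 * c₃)) s * kA3end d s x ≤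
      bigK d ^ 18 * kap d ^ (i + c₃) := by
  refine (chain_sup_le (kPsiZero d) (fun s => kA3end d s x) _ _ _ (s := 1)
    (fun p q => by simp [kProp]) (mass_entry_B1 hd i) (mass_exit_B1 hd c₃ x)).trans ?_
  calc bigK d ^ 2 * kap d ^ i * 1 * (bigK d ^ 2 * kap d ^ c₃) = bigK d ^ 4 * kap d ^ (i + c₃) := by ring
    _ ≤ bigK d ^ 18 * kap d ^ (i + c₃) := mul_le_mul' (bigK_pow_mono hd (by norm_num)) le_rfl

/-- **Both crossed lines of one `B₂⁽¹⁾(2i+1)` erased** (two rungs and a constant kernel):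
`≤ 𝕂¹⁸ κ^{i + c}`. [cite: Hara2008, §3.5] -/
theorem cfg_same_B2 (hd : 1 ≤ d) (i c₃ : ℕ) (x : Site d) :
    ∑' s, pkChainL (kPsiZero d) (altL d true (2 * i) ++ kB1 d :: kRungL (kRungR (kPropX (oneF d) (oneF d))) :: kB1 d ::
      altL d false (2 * c₃)) s * kA3end d s x ≤ bigK d ^ 18 * kap d ^ (i + c₃) := by
  -- move the two rungs onto the neighbouring `B₁`'s
  have hlist : pkChainL (kPsiZero d) (altL d true (2 * i) ++ kB1 d :: kRungL (kRungR (kPropX (oneF d) (oneF d))) :: kB1 d ::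
      altL d false (2 * c₃)) = pkChainL (kPsiZero d) ((altL d true (2 * i) ++ [pkScaleR (kB1 d) (rho d)]) ++
        kPropX (oneF d) (oneF d) :: (pkScaleL (rho d) (kB1 d) :: altL d false (2 * c₃))) := by
    rw [kRungL_eq_pkScaleL, pkChainL_append_cons_pkScaleL, kRungR_eq_pkScaleR]
    have hassoc : altL d true (2 * i) ++ pkScaleR (kB1 d) (rho d) :: pkScaleR (kPropX (oneF d) (oneF d)) (rho d) :: kB1 d ::
        altL d false (2 * c₃) = (altL d true (2 * i) ++ [pkScaleR (kB1 d) (rho d)]) ++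
          pkScaleR (kPropX (oneF d) (oneF d)) (rho d) :: kB1 d :: altL d false (2 * c₃) := by
      rw [List.append_assoc]; rfl
    rw [hassoc, ← pkChainL_append_cons_pkScaleL]
  rw [hlist]
  refine (chain_sup_le (kPsiZero d) (fun s => kA3end d s x) _ _ _ (s := 1)
    (fun p q => by simp [kPropX]) (mass_entry_B2 hd i) (mass_exit_B2 hd c₃ x)).trans ?_
  calc bigK d ^ 2 * kap d ^ i * 1 * (bigK d ^ 2 * kap d ^ c₃) = bigK d ^ 4 * kap d ^ (i + c₃) := by ring
    _ ≤ bigK d ^ 18 * kap d ^ (i + c₃) := mul_le_mul' (bigK_pow_mono hd (by norm_num)) le_rfl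

end Literature.Barriers.CriticalPhenomena
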